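import Summits.BirchSwinnertonDyer.BirchSwinnertonDyer.Theorems.CountingDoorF2AtThreeIntModelReduction
import HarnessLib

/-!
# A `3`-descent independence certificate for THREE points (pure group theory), and
# `3 ≤ rank_ℤ E(F)` from three independent points

Cell `bsd-rank2` (D-0036), seat `bsd-rank2-eng-2` GEN 4. Route-free kernel, companion of
`Theorems/CountingDoorF2AtThreeIntModelReduction.lean` (which has the TWO-point certificate
`Theorems.linearIndependent_pair_of_three_descent` and the Lagrange lemma
`Theorems.card_div_three_nsmul_map_eq_zero`); consumed by `Rank2/ToyRankThreeOrderEqualityAtTwo.lean`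
(`rank E₀(ℚ) ≥ 3` for the door-(F*) toy curve `E₀ = [1,4,0,105,0]` of planner p2 G14, memo
`run/shared/lean/pub/bsd-rank2/p2/PADIC-R2-G14.md` §4.4).

* `not_three_dvd_of_cert` — `(#G/3) • f(u) ≠ 0` in a finite homomorphic image `f : M → G` with
  `3 ∣ #G` certifies `u ∉ 3M` (if `u = 3w` then `(#G/3) • f(u) = #G • f(w) = 0`, Lagrange).
* `three_descent_step` — a relation `sP + tQ + uR = 0` whose coefficients are not all divisible by `3`
  puts one of the thirteen representatives of `ℙ²(𝔽₃)` — `P, Q, R, P+Q, P+2Q, P+R, P+2R, Q+R, Q+2R,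
  P+Q+R, P+Q+2R, P+2Q+R, P+2Q+2R` — into `3M` (Bezout against the first coefficient prime to `3`).
* `linearIndependent_triple_of_three_descent` — in an abelian group WITHOUT `3`-torsion, `P, Q, R` are
  `ℤ`-linearly independent once none of the thirteen representatives lies in `3M` (descent on
  `|s| + |t| + |u|`: a relation with all coefficients divisible by `3` divides by `3`).
* `three_le_mordellWeilRank_of_linearIndependent` — glue: `Module.Finite ℤ E(F)` and an independent
  triple give `3 ≤ rank_ℤ E(F)` (the tree's `two_le_mordellWeilRank_of_linearIndependent`, one more point).

THEOREMS ONLY (no definition, no named fact, no `sorry`). PARTITION: none — r_an ≥ 2, summit axis S0;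
TWIN (D-0056): n/a. B1 honesty: elementary abelian-group algebra (Cassels *LEC* §13 «descent by a
prime»; Silverman *AEC* VIII.6.7); nothing here mentions a curve invariant beyond `rank_ℤ`.

References: J. W. S. Cassels, *Lectures on Elliptic Curves* (1991) §13 [folklore]; J. H. Silverman,
*The Arithmetic of Elliptic Curves*, 2nd ed. (2009), Thm. VIII.6.7 [SilvermanAEC2009].
-/

set_option linter.dupNamespace false

noncomputable section

open scoped Classical
open Summit.BirchSwinnertonDyer.BirchSwinnertonDyer.Theorems

namespace Summit.BirchSwinnertonDyer.Rank2

/-! ### §1 Pure group theory: a `3`-descent independence certificate for THREE points -/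

/-- If `u = 3w` in `M` then `(#G/3) • f(u) = 0` in every finite image `f : M → G` with `3 ∣ #G`
(Lagrange: `#G • f(w) = 0`); contrapositive form of the certificate. [folklore] -/
theorem not_three_dvd_of_cert {M G : Type*} [AddCommGroup M] [AddCommGroup G] (f : M →+ G)
    (hG : 3 ∣ Nat.card G) {u : M} (hu : (Nat.card G / 3) • f u ≠ 0) (w : M) : u ≠ (3 : ℤ) • w := by
  intro h
  apply hu
  have h' : u = -((3 : ℤ) • (-w)) := by rw [h, smul_neg, neg_neg]
  exact card_div_three_nsmul_map_eq_zero f hG h'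

/-- One step of the `3`-descent: a relation `s P + t Q + u R = 0` whose coefficients are NOT all
divisible by `3` puts one of the thirteen representatives of `ℙ²(𝔽₃)` — `P`, `Q`, `R`, `P+Q`, `P+2Q`,
`P+R`, `P+2R`, `Q+R`, `Q+2R`, `P+Q+R`, `P+Q+2R`, `P+2Q+R`, `P+2Q+2R` — into `3M`. [folklore] -/
theorem three_descent_step {M : Type*} [AddCommGroup M] (P Q R : M) (s t u : ℤ)
    (hrel : s • P + t • Q + u • R = 0) (hndvd : ¬ ((3 : ℤ) ∣ s ∧ (3 : ℤ) ∣ t ∧ (3 : ℤ) ∣ u)) :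
    (∃ w : M, P = (3 : ℤ) • w) ∨ (∃ w : M, Q = (3 : ℤ) • w) ∨ (∃ w : M, R = (3 : ℤ) • w) ∨
    (∃ w : M, P + Q = (3 : ℤ) • w) ∨ (∃ w : M, P + 2 • Q = (3 : ℤ) • w) ∨
    (∃ w : M, P + R = (3 : ℤ) • w) ∨ (∃ w : M, P + 2 • R = (3 : ℤ) • w) ∨
    (∃ w : M, Q + R = (3 : ℤ) • w) ∨ (∃ w : M, Q + 2 • R = (3 : ℤ) • w) ∨
    (∃ w : M, P + Q + R = (3 : ℤ) • w) ∨ (∃ w : M, P + Q + 2 • R = (3 : ℤ) • w) ∨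
    (∃ w : M, P + 2 • Q + R = (3 : ℤ) • w) ∨ (∃ w : M, P + 2 • Q + 2 • R = (3 : ℤ) • w) := by
  have hmP : Prime (3 : ℤ) := by norm_num
  have cop : ∀ a : ℤ, ¬ (3 : ℤ) ∣ a → ∃ μ β : ℤ, μ * a + β * 3 = 1 := fun a ha ↦ by
    obtain ⟨μ, β, h⟩ := (hmP.irreducible.coprime_iff_not_dvd.mpr ha).symm
    exact ⟨μ, β, h⟩
  -- `x = 3 d + c` with `c ∈ {0, 1, 2}`
  have hdiv : ∀ x : ℤ, ∃ d c : ℤ, x = 3 * d + c ∧ (c = 0 ∨ c = 1 ∨ c = 2) := fun x ↦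
    ⟨x / 3, x % 3, by omega, by omega⟩
  have h0 : ∀ μ : ℤ, μ • (s • P + t • Q + u • R) = 0 := fun μ ↦ by rw [hrel, smul_zero]
  by_cases hs : (3 : ℤ) ∣ s
  · obtain ⟨k, hk⟩ := hs
    by_cases ht : (3 : ℤ) ∣ t
    · obtain ⟨l, hl⟩ := ht
      have hu : ¬ (3 : ℤ) ∣ u := fun hu ↦ hndvd ⟨⟨k, hk⟩, ⟨l, hl⟩, hu⟩
      obtain ⟨μ, β, hμ⟩ := cop u hu
      -- `R = 3 • (β R − μ k P − μ l Q)`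
      refine Or.inr (Or.inr (Or.inl ⟨β • R - (μ * k) • P - (μ * l) • Q, ?_⟩))
      have hw : (3 : ℤ) • (β • R - (μ * k) • P - (μ * l) • Q) = R - μ • (s • P + t • Q + u • R) := by
        rw [hk, hl]
        match_scalars
        · linear_combination hμ
        · ring1
        · ring1
      rw [h0, sub_zero] at hw
      exact hw.symm
    · obtain ⟨μ, β, hμ⟩ := cop t ht
      obtain ⟨d, c, hcu, hc⟩ := hdiv (μ * u)
      -- `Q + c • R = 3 • (β Q − μ k P − d R)`
      have key : Q + c • R = (3 : ℤ) • (β • Q - (μ * k) • P - d • R) := by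
        have hw : (3 : ℤ) • (β • Q - (μ * k) • P - d • R) =
            Q + c • R - μ • (s • P + t • Q + u • R) := by
          rw [hk]
          match_scalars
          · linear_combination hμ
          · ring1
          · linear_combination hcu
        rw [h0, sub_zero] at hw
        exact hw.symm
      rcases hc with h | h | h <;> rw [h] at key
      · exact Or.inr (Or.inl ⟨_, by rwa [zero_smul, add_zero] at key⟩)
      · exact Or.inr (Or.inr (Or.inr (Or.inr (Or.inr (Or.inr (Or.inr (Or.inl
          ⟨_, by rwa [one_smul] at key⟩)))))))
      · exact Or.inr (Or.inr (Or.inr (Or.inr (Or.inr (Or.inr (Or.inr (Or.inr (Or.inl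
          ⟨_, by rwa [ofNat_zsmul] at key⟩))))))))
  · obtain ⟨μ, β, hμ⟩ := cop s hs
    obtain ⟨d₂, c₂, hct, hc₂⟩ := hdiv (μ * t)
    obtain ⟨d₃, c₃, hcu, hc₃⟩ := hdiv (μ * u)
    have key : P + c₂ • Q + c₃ • R = (3 : ℤ) • (β • P - d₂ • Q - d₃ • R) := by
      have hw : (3 : ℤ) • (β • P - d₂ • Q - d₃ • R) =
          P + c₂ • Q + c₃ • R - μ • (s • P + t • Q + u • R) := by
        match_scalars
        · linear_combination hμ
        · linear_combination hct
        · linear_combination hcu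
      rw [h0, sub_zero] at hw
      exact hw.symm
    rcases hc₂ with h₂ | h₂ | h₂ <;> rw [h₂] at key <;> rcases hc₃ with h₃ | h₃ | h₃ <;> rw [h₃] at key
    · exact Or.inl ⟨_, by rwa [zero_smul, zero_smul, add_zero, add_zero] at key⟩
    · exact Or.inr (Or.inr (Or.inr (Or.inr (Or.inr (Or.inl
        ⟨_, by rwa [zero_smul, add_zero, one_smul] at key⟩)))))
    · exact Or.inr (Or.inr (Or.inr (Or.inr (Or.inr (Or.inr (Or.inl
        ⟨_, by rwa [zero_smul, add_zero, ofNat_zsmul] at key⟩))))))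
    · exact Or.inr (Or.inr (Or.inr (Or.inl ⟨_, by rwa [one_smul, zero_smul, add_zero] at key⟩)))
    · refine Or.inr (Or.inr (Or.inr (Or.inr (Or.inr (Or.inr (Or.inr (Or.inr (Or.inr (Or.inl
        ⟨β • P - d₂ • Q - d₃ • R, ?_⟩)))))))))
      rwa [one_smul, one_smul] at key
    · refine Or.inr (Or.inr (Or.inr (Or.inr (Or.inr (Or.inr (Or.inr (Or.inr (Or.inr (Or.inr (Or.inl
        ⟨β • P - d₂ • Q - d₃ • R, ?_⟩))))))))))
      rwa [one_smul, ofNat_zsmul] at key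
    · exact Or.inr (Or.inr (Or.inr (Or.inr (Or.inl
        ⟨_, by rwa [ofNat_zsmul, zero_smul, add_zero] at key⟩))))
    · refine Or.inr (Or.inr (Or.inr (Or.inr (Or.inr (Or.inr (Or.inr (Or.inr (Or.inr (Or.inr (Or.inr
        (Or.inl ⟨β • P - d₂ • Q - d₃ • R, ?_⟩)))))))))))
      rwa [ofNat_zsmul, one_smul] at key
    · refine Or.inr (Or.inr (Or.inr (Or.inr (Or.inr (Or.inr (Or.inr (Or.inr (Or.inr (Or.inr (Or.inr
        (Or.inr ⟨β • P - d₂ • Q - d₃ • R, ?_⟩)))))))))))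
      rwa [ofNat_zsmul, ofNat_zsmul] at key

/-- **The `3`-descent independence certificate for three points (pure group theory).** In an abelian
group `M` WITHOUT `3`-torsion, three elements `P, Q, R` are `ℤ`-linearly independent as soon as none
of the thirteen representatives `P`, `Q`, `R`, `P+Q`, `P+2Q`, `P+R`, `P+2R`, `Q+R`, `Q+2R`, `P+Q+R`,
`P+Q+2R`, `P+2Q+R`, `P+2Q+2R` of `ℙ²(𝔽₃)` lies in `3M`: a dependency with coefficients all divisible by
`3` descends (no `3`-torsion), and a primitive one makes a representative `≡ 0 (mod 3M)` (Cassels,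
*LEC* §13; Silverman *AEC* VIII.6.7 — the three-point analogue of
`Theorems.linearIndependent_pair_of_three_descent`). [cite: SilvermanAEC2009, Thm. VIII.6.7] -/
theorem linearIndependent_triple_of_three_descent {M : Type*} [AddCommGroup M]
    (h3 : ∀ x : M, (3 : ℤ) • x = 0 → x = 0) (P Q R : M)
    (h100 : ∀ w : M, P ≠ (3 : ℤ) • w) (h010 : ∀ w : M, Q ≠ (3 : ℤ) • w)
    (h001 : ∀ w : M, R ≠ (3 : ℤ) • w) (h110 : ∀ w : M, P + Q ≠ (3 : ℤ) • w)
    (h120 : ∀ w : M, P + 2 • Q ≠ (3 : ℤ) • w) (h101 : ∀ w : M, P + R ≠ (3 : ℤ) • w)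
    (h102 : ∀ w : M, P + 2 • R ≠ (3 : ℤ) • w) (h011 : ∀ w : M, Q + R ≠ (3 : ℤ) • w)
    (h012 : ∀ w : M, Q + 2 • R ≠ (3 : ℤ) • w) (h111 : ∀ w : M, P + Q + R ≠ (3 : ℤ) • w)
    (h112 : ∀ w : M, P + Q + 2 • R ≠ (3 : ℤ) • w) (h121 : ∀ w : M, P + 2 • Q + R ≠ (3 : ℤ) • w)
    (h122 : ∀ w : M, P + 2 • Q + 2 • R ≠ (3 : ℤ) • w) :
    LinearIndependent ℤ ![P, Q, R] := by
  -- no representative is in `3M`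
  have hstep : ∀ s t u : ℤ, s • P + t • Q + u • R = 0 → ((3 : ℤ) ∣ s ∧ (3 : ℤ) ∣ t ∧ (3 : ℤ) ∣ u) := by
    intro s t u hrel
    by_contra hnd
    rcases three_descent_step P Q R s t u hrel hnd with ⟨w, h⟩ | ⟨w, h⟩ | ⟨w, h⟩ | ⟨w, h⟩ | ⟨w, h⟩ |
        ⟨w, h⟩ | ⟨w, h⟩ | ⟨w, h⟩ | ⟨w, h⟩ | ⟨w, h⟩ | ⟨w, h⟩ | ⟨w, h⟩ | ⟨w, h⟩
    exacts [h100 w h, h010 w h, h001 w h, h110 w h, h120 w h, h101 w h, h102 w h, h011 w h,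
      h012 w h, h111 w h, h112 w h, h121 w h, h122 w h]
  -- descent on `|s| + |t| + |u|`
  have key : ∀ n : ℕ, ∀ s t u : ℤ, s.natAbs + t.natAbs + u.natAbs = n →
      s • P + t • Q + u • R = 0 → s = 0 ∧ t = 0 ∧ u = 0 := by
    intro n
    induction n using Nat.strong_induction_on with
    | _ n ih =>
      intro s t u hn hrel
      by_cases h0 : s = 0 ∧ t = 0 ∧ u = 0
      · exact h0
      obtain ⟨⟨s', hs'⟩, ⟨t', ht'⟩, ⟨u', hu'⟩⟩ := hstep s t u hrel
      have hrel' : (3 : ℤ) • (s' • P + t' • Q + u' • R) = 0 := by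
        rw [← hrel, hs', ht', hu']
        module
      have e3 : (3 : ℤ).natAbs = 3 := rfl
      have h' := ih (s'.natAbs + t'.natAbs + u'.natAbs) (by
        subst hn; rw [hs', ht', hu', Int.natAbs_mul, Int.natAbs_mul, Int.natAbs_mul, e3]
        have : ¬ (s' = 0 ∧ t' = 0 ∧ u' = 0) := by
          rintro ⟨rfl, rfl, rfl⟩; simp [hs', ht', hu'] at h0
        omega) s' t' u' rfl (h3 _ hrel')
      obtain ⟨rfl, rfl, rfl⟩ := h'
      simp [hs', ht', hu'] at h0
  rw [Fintype.linearIndependent_iff]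
  intro g hg
  have hsum : g 0 • P + g 1 • Q + g 2 • R = 0 := by
    simpa [Fin.sum_univ_three] using hg
  obtain ⟨h0, h1, h2⟩ := key _ _ _ _ rfl hsum
  intro i
  fin_cases i <;> assumption

/-- **Three `ℤ`-linearly independent points give `3 ≤ rank_ℤ E(F)`** in a finitely generated `E(F)`
(`LinearIndependent.fintype_card_le_finrank`; `rank_ℤ = finrank_ℤ`). [cite: SilvermanAEC2009, Thm. VIII.6.7] -/
theorem three_le_mordellWeilRank_of_linearIndependent {F : Type*} [Field F]
    (W : WeierstrassCurve F) (hfin : Module.Finite ℤ W.toAffine.Point) {P Q R : W.toAffine.Point}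
    (h : LinearIndependent ℤ ![P, Q, R]) : 3 ≤ W.mordellWeilRank := by
  haveI := hfin
  have := h.fintype_card_le_finrank
  simpa [WeierstrassCurve.mordellWeilRank] using this

end Summit.BirchSwinnertonDyer.Rank2

end
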